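import Summits.ValiantsHypothesis.ValiantsHypothesis.Theorems.BarrierLeverChowBenchmarkPairsDirichletWindow

/-!
# Route BarrierLever — item 22038 `ChowBenchmarkPairs`, line `moore-peel`: the ONE-PARAMETER GROUP of Dirichlet
# zeta matrices (`F^x · F^y = F^{x+y}`, rising-factorial Chu–Vandermonde) — the engine of rule (R3) of THEOREM W

Helper file (`--supports stmt-ValiantsHypothesis-22038`; cell valiant-natproofs, rung V4, 𝒟-side benchmark of
record, line `moore_peel`, card v12d structural target #1; seat val-np-p4 gen 27, memo
`HOME/val-np-p4/g27/MEMO-valnp4-g27.md` §1).  Closes NO item.  Two auxiliary definitions (`dz x a b`, the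
Dirichlet zeta kernel on codes, and `dzDiag x N off`, its unipotent diagonal window).

* `rising_add` — Chu–Vandermonde for rising factorials:
  `(x+y)^{(n)} = Σ_{i+j=n} C(n,i) · x^{(i)} · y^{(j)}` (induction with `Finset.sum_antidiagonal_choose_succ_mul`).
* `dz x a b = [bits a ⊆ bits b] · x^{(|bits b| - |bits a|)}`; `dirichletWindow x i c j m = dz x j (c+m)`.
* **`sum_dz_mul_dz`** — the group law on codes: `Σ_{u ∈ [off, off+N)} dz x a u · dz y u b = dz (x+y) a b`
  whenever `off ≤ a` and `b < off + N` (every set between `bits a` and `bits b` has its code in `[a, b]`; the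
  interval `[bits a, bits b]` of the Boolean lattice is a translated power set, `Finset.sum_powerset_apply_card`).
* `dz_zero` (`F^0 = 1`), top-bit entries `dz_two_pow_add_right/_add_add/_add_left`, and `det_dzDiag`
  (`F^x` restricted to any window of codes on the diagonal is upper unitriangular, determinant `1`).

WHAT THIS IS NOT: nothing on the segment-mean stub, on crux stmt-ValiantsHypothesis-14610 or on `VP` versus `VNP`.
-/

set_option linter.dupNamespace false

namespace Summit.ValiantsHypothesis.ValiantsHypothesis.Theorems.BarrierLever.MoorePeel

open Finset Matrix

variable {R : Type*} [CommRing R]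

/-! ## 1. Chu–Vandermonde for rising factorials -/

/-- `x^{(n)} · (x + n) = x^{(n+1)}` (right recursion). -/
theorem rising_succ_right (n : ℕ) (x : R) : rising (n + 1) x = rising n x * (x + n) := by
  rw [rising_eq_eval_ascPochhammer, rising_eq_eval_ascPochhammer, ascPochhammer_succ_eval]

/-- **Chu–Vandermonde for rising factorials**: `(x+y)^{(n)} = Σ_{i+j=n} C(n,i) x^{(i)} y^{(j)}`. -/
theorem rising_add (n : ℕ) (x y : R) : rising n (x + y) =
    ∑ ij ∈ antidiagonal n, (n.choose ij.1 : R) * (rising ij.1 x * rising ij.2 y) := by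
  induction n generalizing x y with
  | zero => simp
  | succ n ih =>
    rw [Finset.sum_antidiagonal_choose_succ_mul (fun i j => rising i x * rising j y) n, rising_succ]
    have e1 : x * rising n (x + y + 1) =
        ∑ ij ∈ antidiagonal n, (n.choose ij.1 : R) * (rising (ij.1 + 1) x * rising ij.2 y) := by
      rw [show x + y + 1 = (x + 1) + y by ring, ih, Finset.mul_sum]
      refine Finset.sum_congr rfl fun ij _ => ?_
      rw [rising_succ _ x]; ring
    have e2 : y * rising n (x + y + 1) =
        ∑ ij ∈ antidiagonal n, (n.choose ij.1 : R) * (rising ij.1 x * rising (ij.2 + 1) y) := by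
      rw [show x + y + 1 = x + (y + 1) by ring, ih, Finset.mul_sum]
      refine Finset.sum_congr rfl fun ij _ => ?_
      rw [rising_succ _ y]; ring
    rw [add_mul, e1, e2, add_comm]
    congr 1
    refine Finset.sum_congr rfl fun ij hij => ?_
    have hn : n = ij.1 + ij.2 := (Finset.HasAntidiagonal.mem_antidiagonal.mp hij).symm
    rw [Nat.choose_symm_of_eq_add hn]

/-- Range form of Chu–Vandermonde. -/
theorem rising_add_range (n : ℕ) (x y : R) : rising n (x + y) =
    ∑ m ∈ range (n + 1), (n.choose m : R) * (rising m x * rising (n - m) y) := by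
  rw [rising_add, Finset.Nat.sum_antidiagonal_eq_sum_range_succ_mk]

/-! ## 2. The Dirichlet zeta kernel on codes -/

/-- The Dirichlet zeta kernel on codes: `dz x a b = [bits a ⊆ bits b] · x^{(|bits b| - |bits a|)}`. -/
def dz (x : R) (a b : ℕ) : R :=
  if bits a ⊆ bits b then rising ((bits b).card - (bits a).card) x else 0

/-- Unfolding `dz`. -/
theorem dz_def (x : R) (a b : ℕ) :
    dz x a b = if bits a ⊆ bits b then rising ((bits b).card - (bits a).card) x else 0 := rfl

/-- The window matrix in terms of the kernel. -/
theorem dirichletWindow_eq_dz (x : R) (i c : ℕ) (j m : Fin i) :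
    dirichletWindow x i c j m = dz x (j : ℕ) (c + (m : ℕ)) := rfl

/-- Off the containment relation the kernel vanishes. -/
theorem dz_of_not_subset (x : R) {a b : ℕ} (h : ¬ bits a ⊆ bits b) : dz x a b = 0 := by
  rw [dz, if_neg h]

/-- In particular `dz x a b = 0` for `b < a`. -/
theorem dz_of_lt (x : R) {a b : ℕ} (h : b < a) : dz x a b = 0 :=
  dz_of_not_subset x fun hs => absurd (le_of_bits_subset hs) (not_le.mpr h)

/-- Diagonal: `dz x a a = 1`. -/
@[simp] theorem dz_self (x : R) (a : ℕ) : dz x a a = 1 := by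
  rw [dz, if_pos (subset_refl _), Nat.sub_self, rising_zero]

/-- `0^{(n)} = [n = 0]`. -/
theorem rising_zero_left (n : ℕ) : rising n (0 : R) = if n = 0 then 1 else 0 := by
  cases n with
  | zero => simp
  | succ n => rw [rising_succ, zero_mul, if_neg (Nat.succ_ne_zero n)]

/-- `F^0 = 1`: `dz 0 a b = [a = b]`. -/
theorem dz_zero (a b : ℕ) : dz (0 : R) a b = if a = b then 1 else 0 := by
  rw [dz]
  by_cases hs : bits a ⊆ bits b
  · rw [if_pos hs, rising_zero_left]
    by_cases hab : a = b
    · subst hab; simp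
    · rw [if_neg hab, if_neg]
      intro hc
      apply hab
      have : bits a = bits b :=
        Finset.eq_of_subset_of_card_le hs (Nat.le_of_sub_eq_zero hc)
      exact bits_injective this
  · rw [if_neg hs, if_neg]
    rintro rfl
    exact hs (subset_refl _)

/-- Ring homomorphisms act on the parameter of the kernel. -/
theorem map_dz {S : Type*} [CommRing S] (f : R →+* S) (x : R) (a b : ℕ) :
    f (dz x a b) = dz (f x) a b := by
  rw [dz, dz]
  split_ifs
  · exact map_rising f _ _
  · exact map_zero f

/-! ## 3. The group law `F^x · F^y = F^{x+y}` on codes -/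

/-- Chu–Vandermonde as a power-set sum: `Σ_{V ⊆ D} x^{(|V|)} y^{(|D|-|V|)} = (x+y)^{(|D|)}`. -/
theorem sum_powerset_rising (x y : R) (D : Finset ℕ) :
    ∑ V ∈ D.powerset, rising V.card x * rising (D.card - V.card) y = rising D.card (x + y) := by
  rw [Finset.sum_powerset_apply_card (fun m => rising m x * rising (D.card - m) y), rising_add_range]
  refine Finset.sum_congr rfl fun m _ => ?_
  rw [nsmul_eq_mul]

/-- **The group law on codes.**  For `off ≤ a` and `b < off + N`:
`Σ_{u < N} dz x a (off+u) · dz y (off+u) b = dz (x+y) a b` — every set `U` with `bits a ⊆ U ⊆ bits b` has code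
in `[a, b] ⊆ [off, off+N)`, the sets `U` form the translated power set of `bits b ∖ bits a`, and Chu–Vandermonde
sums the weights. -/
theorem sum_dz_mul_dz (x y : R) {a b off N : ℕ} (ha : off ≤ a) (hb : b < off + N) :
    ∑ u : Fin N, dz x a (off + (u : ℕ)) * dz y (off + (u : ℕ)) b = dz (x + y) a b := by
  -- as a sum over the codes `v ∈ [off, off + N)`
  rw [Fin.sum_univ_eq_sum_range (fun u => dz x a (off + u) * dz y (off + u) b)]
  have eIco : ∑ u ∈ range N, dz x a (off + u) * dz y (off + u) b =
      ∑ v ∈ Finset.Ico off (off + N), dz x a v * dz y v b := by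
    rw [Finset.sum_Ico_eq_sum_range, Nat.add_sub_cancel_left]
  rw [eIco]
  by_cases hab : bits a ⊆ bits b
  · -- restrict to the support `bits a ⊆ bits v ⊆ bits b`
    rw [← Finset.sum_filter_of_ne (p := fun v => bits a ⊆ bits v ∧ bits v ⊆ bits b) (fun v _ hv => by
      constructor
      · by_contra h1; exact hv (by rw [dz_of_not_subset x h1, zero_mul])
      · by_contra h2; exact hv (by rw [dz_of_not_subset y h2, mul_zero]))]
    rw [dz, if_pos hab, ← Finset.card_sdiff_of_subset hab, ← sum_powerset_rising]
    refine Finset.sum_nbij' (fun v => bits v \ bits a) (fun V => bin (bits a ∪ V)) ?_ ?_ ?_ ?_ ?_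
    · intro v hv
      rw [Finset.mem_filter] at hv
      exact Finset.mem_powerset.mpr (Finset.sdiff_subset_sdiff hv.2.2 le_rfl)
    · intro V hV
      rw [Finset.mem_powerset] at hV
      have hVb : V ⊆ bits b := hV.trans Finset.sdiff_subset
      rw [Finset.mem_filter, Finset.mem_Ico, bits_bin]
      refine ⟨⟨ha.trans (le_of_bits_subset (by rw [bits_bin]; exact Finset.subset_union_left)),
        lt_of_le_of_lt (le_of_bits_subset (by rw [bits_bin]; exact Finset.union_subset hab hVb)) hb⟩,
        Finset.subset_union_left, Finset.union_subset hab hVb⟩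
    · intro v hv
      rw [Finset.mem_filter] at hv
      rw [Finset.union_sdiff_of_subset hv.2.1, bin_bits]
    · intro V hV
      rw [Finset.mem_powerset] at hV
      rw [bits_bin, Finset.union_sdiff_cancel_left (Finset.disjoint_of_subset_right hV Finset.disjoint_sdiff)]
    · intro v hv
      rw [Finset.mem_filter] at hv
      obtain ⟨-, hav, hvb⟩ := hv
      rw [dz, if_pos hav, dz, if_pos hvb, Finset.card_sdiff_of_subset hav, Finset.card_sdiff_of_subset hab]
      have h1 := Finset.card_le_card hav
      have h2 := Finset.card_le_card hvb
      congr 2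
      omega
  · rw [dz_of_not_subset _ hab]
    refine Finset.sum_eq_zero fun v _ => ?_
    by_cases h1 : bits a ⊆ bits v
    · have h2 : ¬ bits v ⊆ bits b := fun h2 => hab (h1.trans h2)
      rw [dz_of_not_subset y h2, mul_zero]
    · rw [dz_of_not_subset x h1, zero_mul]

/-- The inverse law: `Σ_u dz x a u · dz (-x) u b = [a = b]` on a window of codes containing `[a, b]`. -/
theorem sum_dz_mul_dz_neg (x : R) {a b off N : ℕ} (ha : off ≤ a) (hb : b < off + N) :
    ∑ u : Fin N, dz x a (off + (u : ℕ)) * dz (-x) (off + (u : ℕ)) b = if a = b then 1 else 0 := by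
  rw [sum_dz_mul_dz x (-x) ha hb, add_neg_cancel, dz_zero]

/-! ## 4. The top bit -/

/-- A low row against a high column: `dz x u (2^k + w) = x · dz (x+1) u w` (`u, w < 2^k`). -/
theorem dz_two_pow_add_right (x : R) {k u w : ℕ} (hu : u < 2 ^ k) (hw : w < 2 ^ k) :
    dz x u (2 ^ k + w) = x * dz (x + 1) u w := by
  rw [dz, dz, bits_two_pow_add hw]
  have hk : k ∉ bits u := not_mem_bits_self hu
  by_cases hsub : bits u ⊆ bits w
  · rw [if_pos ((Finset.subset_insert_iff_of_notMem hk).mpr hsub), if_pos hsub,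
      Finset.card_insert_of_notMem (not_mem_bits_self hw)]
    have : (bits u).card ≤ (bits w).card := Finset.card_le_card hsub
    rw [show (bits w).card + 1 - (bits u).card = ((bits w).card - (bits u).card) + 1 by omega, rising_succ]
  · rw [if_neg (fun h' => hsub ((Finset.subset_insert_iff_of_notMem hk).mp h')), if_neg hsub, mul_zero]

/-- A high row against a high column: `dz x (2^k + j) (2^k + w) = dz x j w` (`j, w < 2^k`). -/
theorem dz_two_pow_add_add (x : R) {k j w : ℕ} (hj : j < 2 ^ k) (hw : w < 2 ^ k) :
    dz x (2 ^ k + j) (2 ^ k + w) = dz x j w := by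
  rw [dz, dz, bits_two_pow_add hj, bits_two_pow_add hw]
  have hkj : k ∉ bits j := not_mem_bits_self hj
  have hkw : k ∉ bits w := not_mem_bits_self hw
  have e : insert k (bits j) ⊆ insert k (bits w) ↔ bits j ⊆ bits w := by
    rw [Finset.insert_subset_iff, Finset.subset_insert_iff_of_notMem hkj]
    exact ⟨fun h => h.2, fun h => ⟨Finset.mem_insert_self _ _, h⟩⟩
  by_cases hsub : bits j ⊆ bits w
  · rw [if_pos (e.mpr hsub), if_pos hsub, Finset.card_insert_of_notMem hkj,
      Finset.card_insert_of_notMem hkw, Nat.add_sub_add_right]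
  · rw [if_neg (fun h' => hsub (e.mp h')), if_neg hsub]

/-- A high row against a low column vanishes: `dz x (2^k + j) t = 0` (`j, t < 2^k`). -/
theorem dz_two_pow_add_left (x : R) {k j t : ℕ} (hj : j < 2 ^ k) (ht : t < 2 ^ k) :
    dz x (2 ^ k + j) t = 0 := by
  refine dz_of_not_subset x fun hsub => ?_
  rw [bits_two_pow_add hj, Finset.insert_subset_iff] at hsub
  exact not_mem_bits_self ht hsub.1

/-! ## 5. Diagonal windows of `F^x` are unipotent -/

/-- The diagonal window `(dz x (off + a) (off + b))_{a, b < N}` of the Dirichlet zeta matrix. -/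
def dzDiag (x : R) (N off : ℕ) : Matrix (Fin N) (Fin N) R :=
  Matrix.of fun a b => dz x (off + (a : ℕ)) (off + (b : ℕ))

/-- Entries of the diagonal window. -/
theorem dzDiag_apply (x : R) (N off : ℕ) (a b : Fin N) :
    dzDiag x N off a b = dz x (off + (a : ℕ)) (off + (b : ℕ)) := rfl

/-- Diagonal windows are upper unitriangular: determinant `1`. -/
theorem det_dzDiag (x : R) (N off : ℕ) : (dzDiag x N off).det = 1 := by
  have tri : (dzDiag x N off).BlockTriangular id := by
    intro a b hab
    have hab' : (b : ℕ) < (a : ℕ) := hab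
    exact dz_of_lt x (by omega)
  rw [Matrix.det_of_upperTriangular tri]
  simp [dzDiag_apply]

end Summit.ValiantsHypothesis.ValiantsHypothesis.Theorems.BarrierLever.MoorePeel
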